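import Mathlib
import Literature.MathematicalPhysics.QuantumFieldTheory.YangMillsOS
import HarnessLib

/-!
# MaximalTorusCentralizer

Topic `Literature/RepresentationTheory/CompactGroups`. Named literature fact(s) relocated by the gate from `Summits/QuantumFields/YangMills/Theorems/SmallCircleAnchorAbelianisingDeformation.lean`
(accept-time relocation of `[cite]`d propositions written inline in a Summits proposal; human ruling 2026-08-15).
Sources: BrockerTomDieck1985.

* `Literature.RepresentationTheory.CompactGroups.ExistsAbelianCentralizer`
-/

namespace Literature.RepresentationTheory.CompactGroups

open Literature.MathematicalPhysics.QuantumFieldTheory Literature.MathematicalPhysics.QuantumLattice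

/-- **A generator of a maximal torus has abelian centraliser.**  Let `G` be a compact connected
Lie group — in the tree's vocabulary: a compact connected topological group with a faithful
continuous unitary matrix representation (`HasFaithfulUnitaryRep G N`; such a `G` is a closed
subgroup of `U(N)`, hence a Lie group, Bröcker–tom Dieck III (4.1) with I (3.11); the data of the
tree's `HasFaithfulUnitaryRep G N` / `LatticeRep G`, unfolded so that the fact is stated over
Mathlib alone).  A maximal torus `T ⊆ G` satisfies `Z(T) = T` (IV (2.3)(i)), and by Kronecker's
theorem (I (4.13)) `T` has a topological generator `t`, whence `Z(t) = Z(T) = T`; in particular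
some `t ∈ G` has an abelian centraliser.  (Connectedness is essential: the extraspecial group
`2^{1+4}` has no such element.)
[cite: BrockerTomDieck1985, IV (2.3)(i) and I (4.13)] [file RepresentationTheory/CompactGroups/MaximalTorusCentralizer] -/
def ExistsAbelianCentralizer : Prop :=
  ∀ (G : Type*) [Group G] [TopologicalSpace G] [IsTopologicalGroup G] [CompactSpace G]
    [ConnectedSpace G] (N : ℕ) (ρ : G →* Matrix (Fin N) (Fin N) ℂ), Continuous ρ →
    Function.Injective ρ → (∀ g, ρ g ∈ Matrix.unitaryGroup (Fin N) ℂ) →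
    ∃ t : G, ∀ a b : G, a * t = t * a → b * t = t * b → a * b = b * a

end Literature.RepresentationTheory.CompactGroups

namespace Literature.RepresentationTheory.CompactGroups

/-- **An element with abelian centraliser — general (non-unitary) form.**  For a compact connected
topological group `G` with a faithful continuous matrix representation `ρ : G →* M_N(ℂ)` (its
image is a compact subgroup of `GL_N(ℂ)`, conjugate into `U(N)` by Weyl's unitarian trick, hence
`G` is a compact connected Lie group, Bröcker–tom Dieck III (4.1) with I (3.11)), a topological
generator `g₀` of a maximal torus `T` (Kronecker, I (4.13)) has `Z(g₀) = Z(T) = T` (IV (2.3)(i));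
in particular some `g₀ ∈ G` has an abelian centraliser.  This is the form WITHOUT the unitarity
hypothesis of `ExistsAbelianCentralizer` (which it implies, `ExistsAbelianCentralizer.of_compactLie`);
it is the `hfact` hypothesis, verbatim, of
`Summits/QuantumFields/YangMills/Theorems/SmallCircleAnchorAbelianisingDeformation.lean`.
(Restores the declaration of this name first landed here by the `OneLayerAnchor` prover and
removed when the accept-time relocation p102091 rewrote this file as new; statement reconstructed
verbatim from that `hfact`.)
[cite: BrockerTomDieck1985, IV (2.3)(i) and I (4.13)] -/
def compactLie_exists_abelian_centralizer : Prop :=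
  ∀ (G : Type) [Group G] [TopologicalSpace G] [IsTopologicalGroup G] [CompactSpace G]
    [ConnectedSpace G] (N : ℕ) (ρ : G →* Matrix (Fin N) (Fin N) ℂ), Continuous ρ →
    Function.Injective ρ → ∃ g₀ : G, ∀ a b : G, a * g₀ = g₀ * a → b * g₀ = g₀ * b → a * b = b * a

/-- The general form implies the unitary form (drop the unitarity hypothesis). [folklore] -/
theorem ExistsAbelianCentralizer.of_compactLie (h : compactLie_exists_abelian_centralizer) :
    ExistsAbelianCentralizer.{0} :=
  fun G _ _ _ _ _ N ρ hc hi _ => h G N ρ hc hi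

end Literature.RepresentationTheory.CompactGroups
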